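import Literature.NumberTheory.DiophantineGeometry.AVKernelHopf
import Literature.NumberTheory.DiophantineGeometry.AVIsogenyTate
import HarnessLib

/-!
# Route PhantomRMYoshida — FaltingsFinitenessI (item stmt-Langlands-15084), line `Sketch`: the geometric kernel of an isogeny is killed by its degree

Helper file for the line `Sketch` of the crux `PhantomRMYoshida.FaltingsFinitenessI`
(item stmt-Langlands-15084, Faltings' Finiteness I over `ℚ` by counting geometric kernels inside
`A[N!](ℚ̄)`).  It supplies the containment step of that line, the registered stub
`stub_ker_geomPointsMap_le_geomTorsion`:

  for an isogeny `g : A ⟶ B` of abelian varieties over any field `K`,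
  `ker (g : A(K̄) →+ B(K̄)) ≤ A[deg g](K̄)`, with `deg g = Hom.kerRank g`
  the order of the finite group scheme `Ker g`.

This is Deligne's theorem "a finite commutative group scheme is killed by its order"
(Görtz–Wedhorn, *Algebraic Geometry II*, Prop. 27.86, with Cor. 27.177 identifying the order of
`Ker g` with `deg g`), which the tree already proves scheme-theoretically, for `T`-valued points
over an arbitrary `K`-scheme `T`, as
`Literature.AlgebraicGeometry.Motives.AbelianVariety.IsIsogeny.kerPoints_le_kerPoints_nsmul :
  kerPoints T g ≤ kerPoints T (kerRank g • 𝟙 A)`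
(`Literature/NumberTheory/DiophantineGeometry/AVKernelHopf.lean`).  Here it is read on
`K̄`-points, `T = Spec K̄`, in the additive language of the `Γ_K`-module
`A.geomPoints = Additive (A.Points K̄)` (`AVGaloisModule`), of
`Hom.geomPointsMap g : A.geomPoints →+ B.geomPoints` (`AVIsogenyTate`) and of the geometric torsion
`A.geomTorsion n = AddSubgroup.torsionBy A.geomPoints n`:

* `stub_ker_geomPointsMap_le_geomTorsion` — the registered stub, verbatim;
* `ker_geomPointsMap_le_geomTorsion` — the same statement under its descriptive name.

Pure-proof file, no definitions, no new named facts.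
-/

set_option linter.dupNamespace false -- as in the sibling Theorems files: `Summit.Langlands.Langlands` is the mandated namespace (summit = sub-problem)

noncomputable section

open CategoryTheory
open Literature.AlgebraicGeometry.Motives
open Literature.AlgebraicGeometry.Motives.AbelianVariety

universe u

namespace Summit.Langlands.Langlands.Theorems.PhantomRMYoshida

/-- **The geometric kernel of an isogeny is killed by its degree** (registered stub of the line
`Sketch` of item stmt-Langlands-15084): for an isogeny `g : A → B` of abelian varieties over a
field `K`, every `P ∈ A(K̄)` with `g(P) = 0` satisfies `(deg g) • P = 0`, where
`deg g = Hom.kerRank g = dim_K Γ(Ker g, 𝒪)` is the order of the finite group scheme `Ker g`;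
i.e. `ker (A(K̄) → B(K̄)) ≤ A[deg g](K̄)`.  Deligne's theorem (Görtz–Wedhorn II, Prop. 27.86,
with Cor. 27.177), in the tree as the scheme-theoretic containment
`IsIsogeny.kerPoints_le_kerPoints_nsmul : Ker g (T) ≤ Ker [deg g]_A (T)`, read at `T = Spec K̄`:
`g(P) = 0` says `toMul P ∈ Ker g (Spec K̄)` (`Hom.geomPointsMap_apply`, `Hom.mem_kerPoints_iff`),
hence `toMul P ∈ Ker [deg g]_A (Spec K̄)`, i.e. `toMul P ^ deg g = 1` (`mem_kerPoints_nsmul_iff`),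
which is `P ∈ A[deg g]` (`mem_geomTorsion_iff`, `mem_torsionPoints_iff`, `zpow_natCast`).
[cite: GortzWedhorn2023, Prop. 27.86 and Cor. 27.177] -/
theorem stub_ker_geomPointsMap_le_geomTorsion {K : Type u} [Field K] {A B : AbelianVariety K}
    (g : A ⟶ B) (hg : IsIsogeny g) :
    (Hom.geomPointsMap g).ker ≤ A.geomTorsion (Hom.kerRank g : ℤ) := by
  intro P hP
  -- `g(P) = 0` on `K̄`-points: `toMul P ≫ g = 1`, i.e. `toMul P ∈ Ker g (Spec K̄)`
  have hx : (Additive.toMul P : A.Points (AlgebraicClosure K)) ∈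
      Hom.kerPoints (specOver K (AlgebraicClosure K)) g := by
    have h := congrArg Additive.toMul (show Hom.geomPointsMap g P = 0 from hP)
    rw [Hom.geomPointsMap_apply, AlgPoints.map_apply] at h
    rwa [Hom.mem_kerPoints_iff]
  -- Deligne: `Ker g (Spec K̄) ≤ Ker [deg g]_A (Spec K̄)`, i.e. `toMul P ^ kerRank g = 1`
  rw [mem_geomTorsion_iff, mem_torsionPoints_iff, zpow_natCast]
  exact (mem_kerPoints_nsmul_iff _ _).mp (hg.kerPoints_le_kerPoints_nsmul _ hx)

/-- **The geometric kernel of an isogeny is killed by its degree** (descriptive name of the stub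
`stub_ker_geomPointsMap_le_geomTorsion`): for an isogeny `g : A → B` of abelian varieties over a
field `K`, `ker (A(K̄) → B(K̄)) ≤ A[deg g](K̄)` with `deg g = Hom.kerRank g` the order of the finite
group scheme `Ker g` (Deligne's theorem; Görtz–Wedhorn II, Prop. 27.86 with Cor. 27.177; in the tree
`IsIsogeny.kerPoints_le_kerPoints_nsmul`, read on `K̄`-points).
[cite: GortzWedhorn2023, Prop. 27.86 and Cor. 27.177] -/
theorem ker_geomPointsMap_le_geomTorsion {K : Type u} [Field K] {A B : AbelianVariety K}
    {g : A ⟶ B} (hg : IsIsogeny g) :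
    (Hom.geomPointsMap g).ker ≤ A.geomTorsion (Hom.kerRank g : ℤ) :=
  stub_ker_geomPointsMap_le_geomTorsion g hg

end Summit.Langlands.Langlands.Theorems.PhantomRMYoshida

end
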